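import Summits.RiemannHypothesis.RiemannHypothesis.Theorems.PfPersistencePerronFakeNodelessLobeLaw
import Summits.RiemannHypothesis.RiemannHypothesis.Theorems.PfPersistencePerronFakeNodelessFoldGain
import HarnessLib

/-!
# PF persistence — PERRON-FAKE (S6), part 6c: NODAL-MASS BOUNDS for ground states of the full windowed
# form (table-blind bounds on the lobe coupling; "a large gap forces a light lobe"), hypotheses by name

`pub-rhpf` cell, unit `pub-rhpf-prover-perron` (S6; CASE-DAG §6 row PERRON-FAKE; leaves G1.01 / G1.02,
FAKE column; table-side reading of leaves G1.12 / G1.13 / G1.19).  **Mechanism / rigidity campaign;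
no RH claims.**  RH-free, definition-free: Mathlib + proved tree files only.

Part 6b (`PfPersistencePerronFakeNodelessLobeLaw`) proved the two-level law of a real ground state `u`
of `Q = Q^w_a = tableClosedForm a w` (every real table, every window): under a spectral-gap hypothesis
`γ` BY NAME, `γ · pq ≤ b = −∫ u⁻ S^w_u` (`p = ∫(u⁺)²`, `q = ∫(u⁻)²`, `p + q = 1`).  This part bounds
the lobe coupling `b` from ABOVE by table-blind window quantities and reads off explicit bounds on the
nodal masses.

* §5 (PROVED) **coupling bounds**: for a NON-NEGATIVE table (`w ≥ 0` on the prime index) at every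
  window, `b ≤ 2cosh a · (∫u⁺)(∫u⁻)` (`lobeCoupling_le_polar`: the archimedean and prime channels of
  the source are `≥ 0`, two window points are at distance `≤ 2a`); for EVERY real table below the first
  atom (`2a < log 2`), `b ≤ (2cosh a − ρ(2a)) · (∫u⁺)(∫u⁻)` (`lobeCoupling_le_smallPrime`, part 5c's
  fold-gain law through part 3's fold identity); and the window Cauchy–Schwarz
  `(∫u⁺)(∫u⁻) ≤ 2a √(pq)` (`lobeL1_mul_le`).
* §6 (PROVED) **nodal-mass bounds, full class**: `γ · pq ≤ 4a cosh a · √(pq)`, i.e. for `γ > 0`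
  `pq ≤ (4a cosh a / γ)²` (`IsTableGround.gap_mul_lobeMass_le_polar`, `IsTableGround.lobeMass_le_of_gap`;
  non-negative tables, every window), and `pq ≤ (2a · max(2cosh a − ρ(2a), 0) / γ)²`
  (`IsTableGround.lobeMass_le_of_gap_smallPrime`; every real table, `2a < log 2` — at `ρ(2a) ≥ 2cosh a`
  this is part 2's nodelessness again, `pq = 0`).
* §7 (PROVED) **even sector**: the anti-lobe state of an EVEN ground state is even, so the even-sector
  gap hypothesis BY NAME (over even members `⊥ u`) gives the same laws: `IsTableEvenGround.antiLobe_level`,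
  `IsTableEvenGround.gap_mul_lobeMass_le (_source)`, `IsTableEvenGround.lobeMass_le_of_gap`.

Numbers (DERIVED, for the reader; nothing below depends on them): `4a cosh a = 1.4866 / 2.2553 / 3.8840 /
6.1723` at `a = 0.35 / 0.5 / 0.75 / 1`, so the full-class bound is non-vacuous (`pq < 1/4`) once
`γ > 2.973 / 4.511 / 7.768 / 12.345`; below the first atom `2a(2cosh a − ρ(2a)) = 0.0345 / 0.2213 /
0.4154 / 0.6183` at `a = 0.15 / 0.2 / 0.25 / 0.3`.  No gap DATA of any served table is claimed here.

References: R. Courant, D. Hilbert, *Methoden der Mathematischen Physik* I (1924), Kap. VI §6;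
M. Reed, B. Simon, *Methods of Modern Mathematical Physics IV* (1978) §XIII.1, §XIII.12; E. Bombieri,
Rend. Mat. Acc. Lincei (9) 11 (2000) 183–233, Thm 2.  The proofs below do not invoke them as facts.
-/

set_option linter.dupNamespace false

noncomputable section

open MeasureTheory Set Filter Complex
open scoped Real Topology ComplexConjugate

namespace Summit.RiemannHypothesis.RiemannHypothesis.Theorems.PfPersistence

open Literature.NumberTheory.LFunctions
open Summit.RiemannHypothesis.RiemannHypothesis.Theorems.EvenWinsBeyondArch

/-! ## §5 Table-blind bounds on the lobe coupling -/

section Coupling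

variable {a : ℝ} {w : ℕ → ℝ} {u : ℝ → ℝ}

open Summit.RiemannHypothesis.RiemannHypothesis.Theorems.WeilGroundStateMarkovPart
open Summit.RiemannHypothesis.RiemannHypothesis.Theorems.PolarPerronFrobenius
open Summit.RiemannHypothesis.RiemannHypothesis.Theorems.GroundStateSimpleEven
  (integral_norm_le_sqrt_window)

/-- **Polar bound on the lobe coupling (non-negative tables, every window).**  For `w ≥ 0` on the
prime index and a real `u ∈ coreAdm a`: `−∫ u⁻ S^w_u ≤ 2 cosh a · (∫u⁺)(∫u⁻)` — the archimedean and
prime channels of the source are non-negative and two window points are at distance `≤ 2a`.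
[folklore] -/
theorem lobeCoupling_le_polar (hw : ∀ n ∈ weilPrimeIndex a, 0 ≤ w n) (hum : Measurable u)
    (hU : coreAdm a (fun x ↦ ((u x : ℝ) : ℂ))) :
    -∫ y, max (-u y) 0 * tableSource a w u y ≤
      2 * Real.cosh a * ((∫ x, max (u x) 0) * ∫ x, max (-u x) 0) := by
  have hU2 : MemLp (fun x ↦ ((u x : ℝ) : ℂ)) 2 volume := hU.1
  have hu2 : MemLp u 2 volume :=
    MemLp.of_le hU2 hum.aestronglyMeasurable (Eventually.of_forall fun x ↦ by simp)
  have hus' : ∀ x : ℝ, x ∉ Icc (-a) a → u x = 0 := fun x hx ↦ by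
    have h := hU.2.1 x hx
    simpa using h
  have hus : ∀ᵐ x : ℝ, x ∉ Icc (-a) a → u x = 0 := Eventually.of_forall hus'
  have hp1 : Integrable fun x ↦ max (u x) 0 :=
    swg_integrable_of_memLp (swg_memLp_posPart hu2) (swg_posPart_ae_zero hus)
  have hn1 : Integrable fun x ↦ max (-u x) 0 :=
    swg_integrable_of_memLp (swg_memLp_negPart hu2) (swg_negPart_ae_zero hus)
  have hI : Integrable (fun y ↦ max (-u y) 0 * tableSource a w u y) :=
    (tableClosedForm_abs_sub_eq w hum hU).2
  -- the polar channel on the window: `cosh((x−y)/2) ≤ cosh a`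
  have hcont : ∀ y, Continuous fun x : ℝ ↦ Real.cosh ((x - y) / 2) := fun y ↦
    Real.continuous_cosh.comp ((continuous_id.sub continuous_const).div_const 2)
  have hR : ∀ y ∈ Icc (-a) a,
      ∫ x, max (u x) 0 * Real.cosh ((x - y) / 2) ≤ Real.cosh a * ∫ x, max (u x) 0 := by
    intro y hy
    have ha0 : 0 ≤ a := by linarith [hy.1.trans hy.2]
    rw [show Real.cosh a * ∫ x, max (u x) 0 = ∫ x, max (u x) 0 * Real.cosh a by
      rw [integral_mul_const]; ring]
    refine integral_mono (swg_integrable_mul_continuous hp1 (swg_posPart_ae_zero hus) (hcont y))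
      (hp1.mul_const _) fun x ↦ ?_
    by_cases hx : x ∈ Icc (-a) a
    · refine mul_le_mul_of_nonneg_left ?_ (le_max_right _ _)
      rw [Real.cosh_le_cosh, abs_of_nonneg ha0, abs_le]
      constructor
      · linarith [hx.1, hy.2]
      · linarith [hx.2, hy.1]
    · simp only [hus' x hx, max_self, zero_mul, le_refl]
  -- pointwise: `−2cosh a (∫u⁺) · u⁻(y) ≤ u⁻(y) S(y)`
  have hpt : ∀ y, -(2 * Real.cosh a * ∫ x, max (u x) 0) * max (-u y) 0 ≤
      max (-u y) 0 * tableSource a w u y := by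
    intro y
    by_cases hy : y ∈ Icc (-a) a
    · have hA : 0 ≤ ∫ t in Ioi (0 : ℝ),
          weilArchDensity t * (max (u (y + t)) 0 + max (u (y - t)) 0) :=
        setIntegral_nonneg measurableSet_Ioi fun t ht ↦
          mul_nonneg (weilArchDensity_pos ht).le (add_nonneg (le_max_right _ _) (le_max_right _ _))
      have hS : -(2 * Real.cosh a * ∫ x, max (u x) 0) ≤ tableSource a w u y := by
        have h := tableSource_ge_archPolar hw u y
        linarith [hR y hy]
      have h := mul_le_mul_of_nonneg_left hS (le_max_right (-u y) 0)
      linarith [h]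
    · simp only [hus' y hy, neg_zero, max_self, mul_zero, zero_mul, le_refl]
  have hmono := integral_mono (hn1.const_mul _) hI hpt
  rw [integral_const_mul] at hmono
  linarith [hmono]

/-- **Sub-`log 2` bound on the lobe coupling (every real table).**  For `2a < log 2` and a real
`u ∈ coreAdm a`: `−∫ u⁻ S^w_u ≤ (2 cosh a − ρ(2a)) · (∫u⁺)(∫u⁻)` — part 5c's fold-gain law read
through part 3's fold identity (no atom of the table acts below `log 2 / 2`). [folklore] -/
theorem lobeCoupling_le_smallPrime (w : ℕ → ℝ) (hum : Measurable u)
    (hU : coreAdm a (fun x ↦ ((u x : ℝ) : ℂ))) (h2a : 2 * a < Real.log 2) :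
    -∫ y, max (-u y) 0 * tableSource a w u y ≤
      (2 * Real.cosh a - weilArchDensity (2 * a)) * ((∫ x, max (u x) 0) * ∫ x, max (-u x) 0) := by
  have h1 := (tableClosedForm_abs_sub_eq w hum hU).1
  have h2 := foldGain_ge w hum hU h2a
  linarith [h1, h2]

/-- **Window Cauchy–Schwarz for the lobes**: `(∫u⁺)(∫u⁻) ≤ 2a · √(∫(u⁺)² · ∫(u⁻)²)` for a real
`u ∈ coreAdm a` (`0 ≤ a`). [folklore] -/
theorem lobeL1_mul_le (hU : coreAdm a (fun x ↦ ((u x : ℝ) : ℂ))) (ha : 0 ≤ a) :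
    (∫ x, max (u x) 0) * ∫ x, max (-u x) 0 ≤
      2 * a * Real.sqrt ((∫ x, max (u x) 0 ^ 2) * ∫ x, max (-u x) 0 ^ 2) := by
  have hF := coreAdm_posLobe hU
  have hH := coreAdm_negLobe hU
  have h1 := integral_norm_le_sqrt_window ha hF.1 (Eventually.of_forall hF.2.1)
  have h2 := integral_norm_le_sqrt_window ha hH.1 (Eventually.of_forall hH.2.1)
  have e1 : ∫ x, ‖((max (u x) 0 : ℝ) : ℂ)‖ = ∫ x, max (u x) 0 :=
    integral_congr_ae (Eventually.of_forall fun x ↦ by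
      simp only [Complex.norm_real, Real.norm_eq_abs, abs_of_nonneg (le_max_right (u x) 0)])
  have e2 : ∫ x, ‖((max (-u x) 0 : ℝ) : ℂ)‖ = ∫ x, max (-u x) 0 :=
    integral_congr_ae (Eventually.of_forall fun x ↦ by
      simp only [Complex.norm_real, Real.norm_eq_abs, abs_of_nonneg (le_max_right (-u x) 0)])
  have e1' : ∫ x, ‖((max (u x) 0 : ℝ) : ℂ)‖ ^ 2 = ∫ x, max (u x) 0 ^ 2 :=
    integral_norm_sq_ofReal (fun x ↦ max (u x) 0)
  have e2' : ∫ x, ‖((max (-u x) 0 : ℝ) : ℂ)‖ ^ 2 = ∫ x, max (-u x) 0 ^ 2 :=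
    integral_norm_sq_ofReal (fun x ↦ max (-u x) 0)
  rw [e1, e1'] at h1
  rw [e2, e2'] at h2
  have hp : 0 ≤ ∫ x, max (u x) 0 ^ 2 := integral_nonneg fun _ ↦ sq_nonneg _
  have hn0 : 0 ≤ ∫ x, max (-u x) 0 := integral_nonneg fun _ ↦ le_max_right _ _
  calc (∫ x, max (u x) 0) * ∫ x, max (-u x) 0
      ≤ (√(2 * a) * √(∫ x, max (u x) 0 ^ 2)) * (√(2 * a) * √(∫ x, max (-u x) 0 ^ 2)) :=
        mul_le_mul h1 h2 hn0 (by positivity)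
    _ = 2 * a * Real.sqrt ((∫ x, max (u x) 0 ^ 2) * ∫ x, max (-u x) 0 ^ 2) := by
        rw [mul_mul_mul_comm, Real.mul_self_sqrt (by positivity), Real.sqrt_mul hp]

/-- `γ x ≤ K √x` with `γ > 0`, `K, x ≥ 0` forces `x ≤ (K/γ)²`. [folklore] -/
private theorem le_sq_div_of_mul_le_sqrt {γ K x : ℝ} (hγ : 0 < γ) (hK : 0 ≤ K) (hx : 0 ≤ x)
    (h : γ * x ≤ K * Real.sqrt x) : x ≤ (K / γ) ^ 2 := by
  have hs : 0 ≤ Real.sqrt x := Real.sqrt_nonneg x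
  have hx' : Real.sqrt x ^ 2 = x := Real.sq_sqrt hx
  have hKγ : 0 ≤ K / γ := div_nonneg hK hγ.le
  rcases hs.eq_or_lt with h0 | hpos
  · have : x = 0 := by rw [← hx', ← h0]; ring
    rw [this]; positivity
  · have h1 : γ * Real.sqrt x ≤ K := by
      have : γ * Real.sqrt x * Real.sqrt x ≤ K * Real.sqrt x := by
        rw [mul_assoc, ← pow_two, hx']; exact h
      exact le_of_mul_le_mul_right this hpos
    have h2 : Real.sqrt x ≤ K / γ := by rw [le_div_iff₀ hγ]; linarith
    nlinarith [h2, hs, hKγ, hx']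

end Coupling

/-! ## §6 Nodal-mass bounds for ground states (gap hypothesis by name) -/

section NodalMass

variable {a : ℝ} {w : ℕ → ℝ} {u : ℝ → ℝ}

/-- **NODAL-MASS BOUND, non-negative tables, every window (PROVED; gap BY NAME).**  For `w ≥ 0` on
the prime index, `0 ≤ a`, a real ground state `u` of the full class and a gap `γ` below the rest of
the class orthogonal to `u`: `γ · pq ≤ 4a cosh a · √(pq)` (`p = ∫(u⁺)²`, `q = ∫(u⁻)²`). [folklore] -/
theorem IsTableGround.gap_mul_lobeMass_le_polar (hw : ∀ n ∈ weilPrimeIndex a, 0 ≤ w n)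
    (hum : Measurable u) (hG : IsTableGround a w (fun x ↦ ((u x : ℝ) : ℂ))) (ha : 0 ≤ a) {γ : ℝ}
    (hgap : ∀ v : ℝ → ℂ, coreAdm a v → ∫ x, (v x * conj (((u x : ℝ) : ℂ))).re = 0 →
      (tableClosedForm a w (fun x ↦ ((u x : ℝ) : ℂ)) + γ) * ∫ x, ‖v x‖ ^ 2 ≤ tableClosedForm a w v) :
    γ * ((∫ x, max (u x) 0 ^ 2) * ∫ x, max (-u x) 0 ^ 2) ≤
      4 * a * Real.cosh a * Real.sqrt ((∫ x, max (u x) 0 ^ 2) * ∫ x, max (-u x) 0 ^ 2) := by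
  have h1 := hG.gap_mul_lobeMass_le_source hum hgap
  have h2 := lobeCoupling_le_polar hw hum hG.1
  have h3 := mul_le_mul_of_nonneg_left (lobeL1_mul_le hG.1 ha)
    (by positivity : 0 ≤ 2 * Real.cosh a)
  linarith [h1, h2, h3]

/-- **NODAL-MASS BOUND, reader's form**: with a gap `γ > 0`, `pq ≤ (4a cosh a / γ)²` — a nodal ground
state of a non-negative table with a large gap has a light lobe. [folklore] -/
theorem IsTableGround.lobeMass_le_of_gap (hw : ∀ n ∈ weilPrimeIndex a, 0 ≤ w n)
    (hum : Measurable u) (hG : IsTableGround a w (fun x ↦ ((u x : ℝ) : ℂ))) (ha : 0 ≤ a) {γ : ℝ}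
    (hγ : 0 < γ)
    (hgap : ∀ v : ℝ → ℂ, coreAdm a v → ∫ x, (v x * conj (((u x : ℝ) : ℂ))).re = 0 →
      (tableClosedForm a w (fun x ↦ ((u x : ℝ) : ℂ)) + γ) * ∫ x, ‖v x‖ ^ 2 ≤ tableClosedForm a w v) :
    (∫ x, max (u x) 0 ^ 2) * ∫ x, max (-u x) 0 ^ 2 ≤ (4 * a * Real.cosh a / γ) ^ 2 :=
  le_sq_div_of_mul_le_sqrt hγ (by positivity)
    (mul_nonneg (integral_nonneg fun _ ↦ sq_nonneg _) (integral_nonneg fun _ ↦ sq_nonneg _))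
    (hG.gap_mul_lobeMass_le_polar hw hum ha hgap)

/-- **NODAL-MASS BOUND below the first atom, every real table (PROVED; gap BY NAME).**  For
`0 ≤ a`, `2a < log 2`, a real ground state `u` of the full class of ANY real table and a gap `γ`:
`γ · pq ≤ 2a · max(2cosh a − ρ(2a), 0) · √(pq)`. [folklore] -/
theorem IsTableGround.gap_mul_lobeMass_le_smallPrime (hum : Measurable u)
    (hG : IsTableGround a w (fun x ↦ ((u x : ℝ) : ℂ))) (ha : 0 ≤ a) (h2a : 2 * a < Real.log 2)
    {γ : ℝ}
    (hgap : ∀ v : ℝ → ℂ, coreAdm a v → ∫ x, (v x * conj (((u x : ℝ) : ℂ))).re = 0 →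
      (tableClosedForm a w (fun x ↦ ((u x : ℝ) : ℂ)) + γ) * ∫ x, ‖v x‖ ^ 2 ≤ tableClosedForm a w v) :
    γ * ((∫ x, max (u x) 0 ^ 2) * ∫ x, max (-u x) 0 ^ 2) ≤
      2 * a * max (2 * Real.cosh a - weilArchDensity (2 * a)) 0 *
        Real.sqrt ((∫ x, max (u x) 0 ^ 2) * ∫ x, max (-u x) 0 ^ 2) := by
  have h1 := hG.gap_mul_lobeMass_le_source hum hgap
  have h2 := lobeCoupling_le_smallPrime w hum hG.1 h2a
  have hm : 0 ≤ (∫ x, max (u x) 0) * ∫ x, max (-u x) 0 :=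
    mul_nonneg (integral_nonneg fun _ ↦ le_max_right _ _) (integral_nonneg fun _ ↦ le_max_right _ _)
  have h2' : -∫ y, max (-u y) 0 * tableSource a w u y ≤
      max (2 * Real.cosh a - weilArchDensity (2 * a)) 0 * ((∫ x, max (u x) 0) * ∫ x, max (-u x) 0) :=
    h2.trans (mul_le_mul_of_nonneg_right (le_max_left _ _) hm)
  have h3 := mul_le_mul_of_nonneg_left (lobeL1_mul_le hG.1 ha)
    (le_max_right (2 * Real.cosh a - weilArchDensity (2 * a)) 0)
  linarith [h1, h2', h3]

/-- **NODAL-MASS BOUND below the first atom, reader's form**: `pq ≤ (2a·max(2cosh a − ρ(2a),0)/γ)²`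
for every real table, `2a < log 2`, gap `γ > 0`. [folklore] -/
theorem IsTableGround.lobeMass_le_of_gap_smallPrime (hum : Measurable u)
    (hG : IsTableGround a w (fun x ↦ ((u x : ℝ) : ℂ))) (ha : 0 ≤ a) (h2a : 2 * a < Real.log 2)
    {γ : ℝ} (hγ : 0 < γ)
    (hgap : ∀ v : ℝ → ℂ, coreAdm a v → ∫ x, (v x * conj (((u x : ℝ) : ℂ))).re = 0 →
      (tableClosedForm a w (fun x ↦ ((u x : ℝ) : ℂ)) + γ) * ∫ x, ‖v x‖ ^ 2 ≤ tableClosedForm a w v) :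
    (∫ x, max (u x) 0 ^ 2) * ∫ x, max (-u x) 0 ^ 2 ≤
      (2 * a * max (2 * Real.cosh a - weilArchDensity (2 * a)) 0 / γ) ^ 2 :=
  le_sq_div_of_mul_le_sqrt hγ (by positivity)
    (mul_nonneg (integral_nonneg fun _ ↦ sq_nonneg _) (integral_nonneg fun _ ↦ sq_nonneg _))
    (hG.gap_mul_lobeMass_le_smallPrime hum ha h2a hgap)

end NodalMass

/-! ## §7 The even sector: the anti-lobe state of an even ground state is even -/

section EvenSector

variable {a : ℝ} {w : ℕ → ℝ} {u : ℝ → ℝ}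

/-- An even complex cast is an even real function. [folklore] -/
theorem IsTableEvenGround.even_real (hG : IsTableEvenGround a w (fun x ↦ ((u x : ℝ) : ℂ))) (x : ℝ) :
    u (-x) = u x := by
  have h : ((u (-x) : ℝ) : ℂ) = ((u x : ℝ) : ℂ) := hG.2.1 x
  exact_mod_cast h

/-- The anti-lobe state of an even-sector ground state is a member of the class. [folklore] -/
theorem IsTableEvenGround.antiLobe_coreAdm (hG : IsTableEvenGround a w (fun x ↦ ((u x : ℝ) : ℂ))) :
    coreAdm a ((∫ x, max (-u x) 0 ^ 2) • (fun x ↦ ((max (u x) 0 : ℝ) : ℂ)) +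
      (∫ x, max (u x) 0 ^ 2) • fun x ↦ ((max (-u x) 0 : ℝ) : ℂ)) :=
  ((coreAdm_posLobe hG.1).real_smul _).add ((coreAdm_negLobe hG.1).real_smul _)

/-- **Two-level law, even sector**: the anti-lobe state of an even-sector ground state lies at level
`E pq + ¼(Q(|u|) − E)`. [folklore] -/
theorem IsTableEvenGround.antiLobe_level (hG : IsTableEvenGround a w (fun x ↦ ((u x : ℝ) : ℂ))) :
    tableClosedForm a w ((∫ x, max (-u x) 0 ^ 2) • (fun x ↦ ((max (u x) 0 : ℝ) : ℂ)) +
        (∫ x, max (u x) 0 ^ 2) • fun x ↦ ((max (-u x) 0 : ℝ) : ℂ)) =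
      tableClosedForm a w (fun x ↦ ((u x : ℝ) : ℂ)) *
          ((∫ x, max (u x) 0 ^ 2) * ∫ x, max (-u x) 0 ^ 2) +
        (tableClosedForm a w (fun x ↦ ((|u x| : ℝ) : ℂ)) -
            tableClosedForm a w (fun x ↦ ((u x : ℝ) : ℂ))) / 4 := by
  have hpq : (∫ x, max (u x) 0 ^ 2) + ∫ x, max (-u x) 0 ^ 2 = 1 := by
    rw [lobeMass_add hG.1, hG.2.2.1]
  rw [hG.lobePlane hG.even_real]
  set p := ∫ x, max (u x) 0 ^ 2
  set q := ∫ x, max (-u x) 0 ^ 2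
  have h3 : q ^ 2 * p + p ^ 2 * q = p * q := by
    rw [show q ^ 2 * p + p ^ 2 * q = p * q * (p + q) by ring, hpq, mul_one]
  have h4 : (q + p) ^ 2 = 1 := by rw [add_comm, hpq, one_pow]
  rw [h3, h4, mul_one]

/-- **A NODE COSTS GAP, even sector** (the even-sector gap hypothesis BY NAME): if every EVEN member of
the class `L²`-orthogonal to the even ground state `u` lies at level `≥ E + γ`, then
`γ · pq ≤ ¼(Q(|u|) − Q(u))`. [folklore] -/
theorem IsTableEvenGround.gap_mul_lobeMass_le (hG : IsTableEvenGround a w (fun x ↦ ((u x : ℝ) : ℂ)))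
    {γ : ℝ}
    (hgap : ∀ v : ℝ → ℂ, coreAdm a v → (∀ x, v (-x) = v x) →
      ∫ x, (v x * conj (((u x : ℝ) : ℂ))).re = 0 →
      (tableClosedForm a w (fun x ↦ ((u x : ℝ) : ℂ)) + γ) * ∫ x, ‖v x‖ ^ 2 ≤ tableClosedForm a w v) :
    γ * ((∫ x, max (u x) 0 ^ 2) * ∫ x, max (-u x) 0 ^ 2) ≤
      (tableClosedForm a w (fun x ↦ ((|u x| : ℝ) : ℂ)) -
          tableClosedForm a w (fun x ↦ ((u x : ℝ) : ℂ))) / 4 := by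
  have hpq : (∫ x, max (u x) 0 ^ 2) + ∫ x, max (-u x) 0 ^ 2 = 1 := by
    rw [lobeMass_add hG.1, hG.2.2.1]
  have h := hgap _ hG.antiLobe_coreAdm (lobes_even hG.even_real _ _) (antiLobe_orth hG.1)
  rw [antiLobe_mass hG.1, hG.antiLobe_level, hpq, mul_one] at h
  nlinarith [h]

/-- **A NODE COSTS GAP, even sector, source form**: `γ · pq ≤ −∫ u⁻ S^w_u`. [folklore] -/
theorem IsTableEvenGround.gap_mul_lobeMass_le_source (hum : Measurable u)
    (hG : IsTableEvenGround a w (fun x ↦ ((u x : ℝ) : ℂ))) {γ : ℝ}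
    (hgap : ∀ v : ℝ → ℂ, coreAdm a v → (∀ x, v (-x) = v x) →
      ∫ x, (v x * conj (((u x : ℝ) : ℂ))).re = 0 →
      (tableClosedForm a w (fun x ↦ ((u x : ℝ) : ℂ)) + γ) * ∫ x, ‖v x‖ ^ 2 ≤ tableClosedForm a w v) :
    γ * ((∫ x, max (u x) 0 ^ 2) * ∫ x, max (-u x) 0 ^ 2) ≤ -∫ y, max (-u y) 0 * tableSource a w u y := by
  rw [← lobeCoupling_eq_source w hum hG.1]
  exact hG.gap_mul_lobeMass_le hgap

/-- **NODAL-MASS BOUND, even sector, non-negative tables, every window (PROVED; gap BY NAME)**: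
`pq ≤ (4a cosh a / γ)²`. [folklore] -/
theorem IsTableEvenGround.lobeMass_le_of_gap (hw : ∀ n ∈ weilPrimeIndex a, 0 ≤ w n)
    (hum : Measurable u) (hG : IsTableEvenGround a w (fun x ↦ ((u x : ℝ) : ℂ))) (ha : 0 ≤ a)
    {γ : ℝ} (hγ : 0 < γ)
    (hgap : ∀ v : ℝ → ℂ, coreAdm a v → (∀ x, v (-x) = v x) →
      ∫ x, (v x * conj (((u x : ℝ) : ℂ))).re = 0 →
      (tableClosedForm a w (fun x ↦ ((u x : ℝ) : ℂ)) + γ) * ∫ x, ‖v x‖ ^ 2 ≤ tableClosedForm a w v) :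
    (∫ x, max (u x) 0 ^ 2) * ∫ x, max (-u x) 0 ^ 2 ≤ (4 * a * Real.cosh a / γ) ^ 2 := by
  have h1 := hG.gap_mul_lobeMass_le_source hum hgap
  have h2 := lobeCoupling_le_polar hw hum hG.1
  have h3 := mul_le_mul_of_nonneg_left (lobeL1_mul_le hG.1 ha)
    (by positivity : 0 ≤ 2 * Real.cosh a)
  exact le_sq_div_of_mul_le_sqrt hγ (by positivity)
    (mul_nonneg (integral_nonneg fun _ ↦ sq_nonneg _) (integral_nonneg fun _ ↦ sq_nonneg _))
    (by linarith [h1, h2, h3])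

end EvenSector

end Summit.RiemannHypothesis.RiemannHypothesis.Theorems.PfPersistence

end
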